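import Mathlib
import Literature.Computability.AlgebraicComplexity.GenericTorusGrading

/-!
# Crux `FreeSubtorus.OrbitDimensionBound` (stmt-ValiantsHypothesis-16133), line `Sketch` —
# stub `stub_eigenGauge` (a constant gauge adapted to the generalised eigenspaces of `P` and `Q`)

Setting: `P, Q ∈ GL_m(ℂ)` (one exact lift of one generic torus element acting on a determinantal
representation).  Conclusion: there is a constant gauge `(g, h)`, `det g = det h`, and non-zero labels
`lam, mu : Fin m → ℂ` such that every "intertwiner up to `c`" `X` (`P X = (c • X) Q`) becomes, after the
gauge, a matrix `g X h⁻¹` supported on the entries `(i, j)` with `lam i = c · mu j`.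

Proof.  Over `ℂ` the generalised eigenspaces of an endomorphism `p` of a finite-dimensional space form
an internal direct sum (`Module.End.iSup_maxGenEigenspace_eq_top`, `Module.End.independent_maxGenEigenspace`);
collecting bases of the pieces (`DirectSum.IsInternal.collectedBasis`) and reindexing by `Fin m` gives an
ADAPTED basis `b` with labels `lam i` (the eigenvalue of the piece containing `b i`): `b i` lies in the
generalised `lam i`-eigenspace and the `i`-th coordinate of a vector of the generalised `ν`-eigenspace
vanishes unless `lam i = ν` (`exists_basis_adapted_maxGenEigenspace`).  Take such bases `bu` for
`v ↦ P v` and `bw` for `v ↦ Q v`; with `U, W` the matrices whose columns are `bu, bw`, put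
`g = s • U⁻¹`, `h = W⁻¹` with `s ^ m = det U / det W` (`ℂ` algebraically closed), so `det g = det h`.
Then `g X h⁻¹ = s • (U⁻¹ X W)` is `s` times the matrix of `X` in the bases `(bw, bu)`
(`basis_toMatrix_mul_linearMap_toMatrix_mul_basis_toMatrix`), whose `(i, j)` entry is the `i`-th
`bu`-coordinate of `X (bw j)`; since `P X = c X Q`, `X` maps the generalised `mu j`-eigenspace of `Q` into
the generalised `(c · mu j)`-eigenspace of `P` (tree lemma `mapsTo_maxGenEigenspace_of_comp_eq_smul`), so
a non-zero entry forces `lam i = c · mu j`.  The labels are non-zero because `P, Q` are injective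
(`maxGenEigenspace_zero_eq_bot_of_injective`).  Pure linear algebra. [folklore]
-/

-- Sub = Summit single-conjunct layout: the duplicated namespace component is mandated by the tree.
set_option linter.dupNamespace false

noncomputable section

namespace Summit.ValiantsHypothesis.ValiantsHypothesis.Theorems.FreeSubtorusOrbitDimensionBound

open Matrix
open Literature.Computability.AlgebraicComplexity

/-! ### Bases adapted to the generalised eigenspace decomposition -/

/-- **Adapted basis.**  For an endomorphism `p` of an `m`-dimensional complex vector space there are a
basis `b` indexed by `Fin m` and labels `lam : Fin m → ℂ` such that `b i` lies in the generalised
`lam i`-eigenspace of `p` and the `i`-th coordinate of every vector of the generalised `ν`-eigenspace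
vanishes unless `lam i = ν` (collect bases of the generalised eigenspaces, an internal direct sum over
`ℂ`). [folklore] -/
theorem exists_basis_adapted_maxGenEigenspace {V : Type*} [AddCommGroup V] [Module ℂ V]
    [FiniteDimensional ℂ V] (p : Module.End ℂ V) {m : ℕ} (hm : Module.finrank ℂ V = m) :
    ∃ (b : Module.Basis (Fin m) ℂ V) (lam : Fin m → ℂ),
      (∀ i, b i ∈ p.maxGenEigenspace (lam i)) ∧
      ∀ (ν : ℂ) (v : V), v ∈ p.maxGenEigenspace ν → ∀ i, b.repr v i ≠ 0 → lam i = ν := by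
  classical
  have h : DirectSum.IsInternal fun μ : ℂ => p.maxGenEigenspace μ :=
    DirectSum.isInternal_submodule_of_iSupIndep_of_iSup_eq_top p.independent_maxGenEigenspace
      (Module.End.iSup_maxGenEigenspace_eq_top p)
  set cb := h.collectedBasis fun μ => Module.finBasis ℂ (p.maxGenEigenspace μ) with hcb
  let e : (Σ μ : ℂ, Fin (Module.finrank ℂ (p.maxGenEigenspace μ))) ≃ Fin m :=
    cb.indexEquiv (Module.finBasisOfFinrankEq ℂ V hm)
  refine ⟨cb.reindex e, fun i => (e.symm i).1, fun i => ?_, fun ν v hv i hi => ?_⟩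
  · rw [Module.Basis.reindex_apply]
    exact h.collectedBasis_mem _ (e.symm i)
  · show (e.symm i).1 = ν
    rw [Module.Basis.repr_reindex_apply] at hi
    by_contra hne
    rcases hea : e.symm i with ⟨μ, a⟩
    rw [hea] at hne hi
    exact hi (h.collectedBasis_repr_of_mem_ne _ (Ne.symm hne) hv)

/-! ### The gauge -/

/-- An `m`-th root of a ratio of two units: `∃ s ≠ 0, s ^ m * a = b` for `a, b ≠ 0` in `ℂ`
(for `m = 0` this needs `a = b`, which is why the statement is about determinants of
`Fin m`-indexed matrices: both sides are `1` when `m = 0`). [folklore] -/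
theorem exists_scalar_pow_mul_det_eq {m : ℕ} (A B : Matrix (Fin m) (Fin m) ℂ) (hA : A.det ≠ 0)
    (hB : B.det ≠ 0) : ∃ s : ℂ, s ≠ 0 ∧ s ^ m * A.det = B.det := by
  rcases Nat.eq_zero_or_pos m with rfl | hm
  · exact ⟨1, one_ne_zero, by rw [pow_zero, one_mul, Matrix.det_isEmpty, Matrix.det_isEmpty]⟩
  · obtain ⟨s, hs⟩ := IsAlgClosed.exists_pow_nat_eq (B.det / A.det) hm
    refine ⟨s, ?_, ?_⟩
    · rintro rfl
      rw [zero_pow hm.ne'] at hs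
      exact div_ne_zero hB hA hs.symm
    · rw [hs, div_mul_cancel₀ _ hA]

/-- **Registered stub S2 (`stub_eigenGauge`; linear algebra over `ℂ`).**  For `P, Q ∈ GL_m(ℂ)` there
is a constant gauge `(g, h)` with `det g = det h` (bases adapted to the generalised eigenspaces of `P`
and of `Q`) and non-zero labels `lam i`, `mu j` (the corresponding eigenvalues) such that whenever
`P X = (c • X) Q` the entry `(i,j)` of `g X h⁻¹` vanishes unless `lam i = c · mu j` (an intertwiner up
to `c` maps the generalised `μ`-eigenspace of `Q` into the generalised `cμ`-eigenspace of `P`, tree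
`mapsTo_maxGenEigenspace_of_comp_eq_smul`). [folklore] -/
theorem stub_eigenGauge (m : ℕ) (P Q : GL (Fin m) ℂ) :
    ∃ (g h : GL (Fin m) ℂ) (lam mu : Fin m → ℂ),
      (g : Matrix (Fin m) (Fin m) ℂ).det = (h : Matrix (Fin m) (Fin m) ℂ).det ∧
      (∀ i, lam i ≠ 0) ∧ (∀ j, mu j ≠ 0) ∧
      ∀ (c : ℂ) (X : Matrix (Fin m) (Fin m) ℂ),
        (P : Matrix (Fin m) (Fin m) ℂ) * X = (c • X) * (Q : Matrix (Fin m) (Fin m) ℂ) →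
        ∀ i j, ((g : Matrix (Fin m) (Fin m) ℂ) * X *
            ((h⁻¹ : GL (Fin m) ℂ) : Matrix (Fin m) (Fin m) ℂ)) i j ≠ 0 →
          lam i = c * mu j := by
  classical
  -- the endomorphisms `v ↦ P v`, `v ↦ Q v` and their adapted bases
  set p : Module.End ℂ (Fin m → ℂ) := Matrix.toLin' (P : Matrix (Fin m) (Fin m) ℂ) with hp
  set q : Module.End ℂ (Fin m → ℂ) := Matrix.toLin' (Q : Matrix (Fin m) (Fin m) ℂ) with hq
  obtain ⟨bu, lam, hbu, hlam⟩ := exists_basis_adapted_maxGenEigenspace p (Module.finrank_fin_fun ℂ)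
  obtain ⟨bw, mu, hbw, hmu⟩ := exists_basis_adapted_maxGenEigenspace q (Module.finrank_fin_fun ℂ)
  set std : Module.Basis (Fin m) ℂ (Fin m → ℂ) := Pi.basisFun ℂ (Fin m) with hstd
  -- `U⁻¹ = bu.toMatrix std`, `W⁻¹ = bw.toMatrix std`; the scalar `s` fixing the determinant
  have hUdet : (bu.toMatrix std).det ≠ 0 := by
    intro h0
    have := congrArg Matrix.det (bu.toMatrix_mul_toMatrix_flip std)
    rw [Matrix.det_mul, h0, zero_mul, Matrix.det_one] at this
    exact zero_ne_one this
  have hWdet : (bw.toMatrix std).det ≠ 0 := by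
    intro h0
    have := congrArg Matrix.det (bw.toMatrix_mul_toMatrix_flip std)
    rw [Matrix.det_mul, h0, zero_mul, Matrix.det_one] at this
    exact zero_ne_one this
  obtain ⟨s, hs, hsdet⟩ := exists_scalar_pow_mul_det_eq _ _ hUdet hWdet
  let g : GL (Fin m) ℂ :=
    ⟨s • bu.toMatrix std, s⁻¹ • std.toMatrix bu, by
      rw [Matrix.smul_mul, Matrix.mul_smul, smul_smul, mul_inv_cancel₀ hs, one_smul,
        Module.Basis.toMatrix_mul_toMatrix_flip], by
      rw [Matrix.smul_mul, Matrix.mul_smul, smul_smul, inv_mul_cancel₀ hs, one_smul,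
        Module.Basis.toMatrix_mul_toMatrix_flip]⟩
  let h : GL (Fin m) ℂ :=
    ⟨bw.toMatrix std, std.toMatrix bw, Module.Basis.toMatrix_mul_toMatrix_flip _ _,
      Module.Basis.toMatrix_mul_toMatrix_flip _ _⟩
  -- injectivity of `p`, `q` (the matrices are invertible), hence no generalised `0`-eigenspace
  have hpinj : Function.Injective p := by
    have : Function.Injective (P : Matrix (Fin m) (Fin m) ℂ).mulVec :=
      Matrix.mulVec_injective_iff_isUnit.2 P.isUnit
    intro v w hvw
    exact this (by simpa only [hp, Matrix.toLin'_apply] using hvw)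
  have hqinj : Function.Injective q := by
    have : Function.Injective (Q : Matrix (Fin m) (Fin m) ℂ).mulVec :=
      Matrix.mulVec_injective_iff_isUnit.2 Q.isUnit
    intro v w hvw
    exact this (by simpa only [hq, Matrix.toLin'_apply] using hvw)
  refine ⟨g, h, lam, mu, ?_, fun i h0 => ?_, fun j h0 => ?_, fun c X hPX i j hij => ?_⟩
  · -- `det g = s ^ m * det U⁻¹ = det W⁻¹ = det h`
    show (s • bu.toMatrix std).det = (bw.toMatrix std).det
    rw [Matrix.det_smul, Fintype.card_fin, hsdet]
  · have hmem := hbu i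
    rw [h0, maxGenEigenspace_zero_eq_bot_of_injective p hpinj, Submodule.mem_bot] at hmem
    exact bu.ne_zero i hmem
  · have hmem := hbw j
    rw [h0, maxGenEigenspace_zero_eq_bot_of_injective q hqinj, Submodule.mem_bot] at hmem
    exact bw.ne_zero j hmem
  · -- `g X h⁻¹ = s • (matrix of X in the bases bw, bu)`
    have key : (g : Matrix (Fin m) (Fin m) ℂ) * X * ((h⁻¹ : GL (Fin m) ℂ) : Matrix (Fin m) (Fin m) ℂ) =
        s • LinearMap.toMatrix bw bu (Matrix.toLin' X) := by
      show s • bu.toMatrix std * X * std.toMatrix bw = s • LinearMap.toMatrix bw bu (Matrix.toLin' X)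
      rw [Matrix.smul_mul, Matrix.smul_mul,
        ← basis_toMatrix_mul_linearMap_toMatrix_mul_basis_toMatrix bw std bu std,
        hstd, LinearMap.toMatrix_eq_toMatrix', LinearMap.toMatrix'_toLin']
    rw [key, Matrix.smul_apply, smul_eq_mul, LinearMap.toMatrix_apply] at hij
    have hij' : bu.repr (Matrix.toLin' X (bw j)) i ≠ 0 := (mul_ne_zero_iff.1 hij).2
    -- `X` intertwines up to `c`, hence shifts generalised eigenspaces
    have hcomp : p ∘ₗ Matrix.toLin' X = c • (Matrix.toLin' X ∘ₗ q) := by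
      rw [hp, hq, ← Matrix.toLin'_mul, hPX, Matrix.smul_mul, LinearEquiv.map_smul,
        Matrix.toLin'_mul]
    have hmem : Matrix.toLin' X (bw j) ∈ p.maxGenEigenspace (c * mu j) :=
      mapsTo_maxGenEigenspace_of_comp_eq_smul p q (Matrix.toLin' X) c hcomp (mu j) (hbw j)
    exact hlam _ _ hmem i hij'

end Summit.ValiantsHypothesis.ValiantsHypothesis.Theorems.FreeSubtorusOrbitDimensionBound

end
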